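import Literature.Analysis.FluidPDE.VorticityHighPart
import Literature.Analysis.FluidPDE.VorticityDirectionDepletion
import Literature.Analysis.FluidPDE.DepletedKernelBounds
import Literature.Analysis.FluidPDE.LocalHelmholtzSupBound
import Literature.Analysis.FluidPDE.SobolevWholeSpace
import Literature.Analysis.FluidPDE.LipschitzSqIntegrableDecay
import Literature.Analysis.FluidPDE.EnstrophyGronwall
import HarnessLib

/-!
# The Constantin–Fefferman estimate of the vortex stretching term at a fixed time

Analysis/FluidPDE proof file (theorems only), the analytic heart of the discharge of
`Literature.Analysis.FluidPDE.constantin_fefferman` (`NSVorticity.lean`; Constantin–Fefferman,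
Indiana Univ. Math. J. 42 (1993), Theorem of §1; proof following Lemarié-Rieusset 2016, Thm. 11.7).

For a divergence-free `v ∈ C²(ℝ³; ℝ³)` with `v, ∇v, ∇²v ∈ L²`, `∇²v` bounded, vorticity
`ω = curl v`, and Constantin–Fefferman's hypothesis on the direction `ξ = ω/|ω|`,
`√(1 − ⟪ξ(x), ξ(y)⟫²) ≤ |x − y|/ρ` whenever `|ω(x)|, |ω(y)| > Ω`, the stretching term of the
enstrophy balance obeys

  `2 ∫ ⟪ω, (∇v) ω⟫ ≤ ν ∫ |∇ω|² + (C₁ + C₂ ∫|ω|² + C₃ ∫|v|²) ∫|ω|² + C₄ ∫|∇v|²`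

with constants depending only on `ν, Ω, ρ` (`exists_two_mul_integral_stretching_le`). This is the
differential inequality of Lemarié-Rieusset, proof of Thm. 11.7 (last display, p. 371 of the PDF:
`d/dt ‖ω‖₂²/2 ≤ −(ν/2)‖ω‖²_{Ḣ¹} + … + C'ν⁻¹(R^{2/3}‖ω‖₂^{4/3} + M_R(t)²‖ω‖₂²)‖ω‖₂²`) in a form
ready for Grönwall with the integrable-in-time coefficients `∫|ω|²`, `∫|v|²`, `∫|∇v|²`.

## The argument

Split `ω = ω_lo + ω_hi` smoothly at the threshold `R = 2Ω` (`VorticityHighPart.lean`), put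
`u_hi = K ∗ ω_hi` (`C¹`, `contDiff_biotSavart`) and `u_lo = v − u_hi`. Then
`⟪ω, ∇v ω⟫ = [⟪ω_lo, ∇v ω⟫ + ⟪ω_hi, ∇v ω_lo⟫] + ⟪ω_hi, ∇u_lo ω_hi⟫ + ⟪ω_hi, ∇u_hi ω_hi⟫`.

* The bracket is `≤ 8Ω |∇v| |ω|` pointwise.
* `∫⟪ω_hi, ∇u_lo ω_hi⟫` is integrated by parts (`abs_integral_inner_fderiv_apply_le_of_hasCompactSupport`:
  `|∫⟪Z, ∇U Z⟫| ≤ 12 ‖U‖_∞ ∫|Z||∇Z|` for `Z ∈ C¹_c`), with `‖u_lo‖_∞ ≤ 8Ω + C_b‖ω‖₂ + C_v‖v‖₂`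
  (`exists_norm_sub_biotSavart_le`, `LocalHelmholtzSupBound.lean`) and `|∇ω_hi| ≤ (1+2B)|∇ω|`.
* `⟪ω_hi, ∇u_hi ω_hi⟫(x) = |ω_hi(x)|² ⟪ξ, ∇u_hi(x) ξ⟫` and the geometric depletion
  (`exists_abs_inner_fderiv_biotSavart_le`, `VorticityDirectionDepletion.lean`) with the direction
  hypothesis bounds `|⟪ξ, ∇u_hi ξ⟫| ≤ A ∫ min(1,|x−y|/ρ)|x−y|⁻³ |ω_hi(y)| dy ≤ A(c₁‖ω‖₆ + c₂‖ω‖₂)`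
  (`exists_integral_depletedKernel_le`, `DepletedKernelBounds.lean`), and `‖ω‖₆ ≤ K‖∇ω‖₂` (Sobolev,
  `eLpNorm_six_le_eLpNorm_fderiv_two`).
* Young's inequality absorbs `‖∇ω‖₂` into `ν ∫|∇ω|²`.

## References

* P. Constantin, C. Fefferman, Indiana Univ. Math. J. 42 (1993), 775–789, Theorem (§1) and §2.
  [ConstantinFeffermanIndiana1993]
* P. G. Lemarié-Rieusset, *The Navier–Stokes Problem in the 21st Century* (2016), §11.6,
  Thm. 11.7 and its proof (PDF pp. 369–371). [LemarieRieusset2016]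
-/

noncomputable section

open MeasureTheory Set Function Filter Metric Real InnerProductSpace
open _root_.Topology
open scoped ENNReal NNReal RealInnerProductSpace

namespace Literature.Analysis.FluidPDE

-- nested operator types `ℝ³ →L[ℝ] ℝ³ →L[ℝ] ℝ³` (second derivatives)
set_option maxSynthPendingDepth 3

/-! ### Linear algebra helpers -/

/-- `|vᵢ| ≤ ‖v‖` on `ℝ³`. [folklore] -/
theorem abs_coord_le_norm_e3 (v : (EuclideanSpace ℝ (Fin 3))) (i : Fin 3) : |v i| ≤ ‖v‖ := by
  simpa [Real.norm_eq_abs] using PiLp.norm_apply_le v i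

/-- `|tr L| ≤ 3 ‖L‖` on `ℝ³`. [folklore] -/
theorem abs_traceCLM_le_three_mul_opNorm (L : (EuclideanSpace ℝ (Fin 3)) →L[ℝ] (EuclideanSpace ℝ (Fin 3))) : |traceCLM L| ≤ 3 * ‖L‖ := by
  rw [traceCLM_eq_sum_inner (EuclideanSpace.basisFun (Fin 3) ℝ)]
  calc |∑ i, ⟪EuclideanSpace.basisFun (Fin 3) ℝ i, L (EuclideanSpace.basisFun (Fin 3) ℝ i)⟫|
      ≤ ∑ i, |⟪EuclideanSpace.basisFun (Fin 3) ℝ i, L (EuclideanSpace.basisFun (Fin 3) ℝ i)⟫| :=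
        Finset.abs_sum_le_sum_abs _ _
    _ ≤ ∑ _i : Fin 3, ‖L‖ := Finset.sum_le_sum fun i _ => by
        calc |⟪EuclideanSpace.basisFun (Fin 3) ℝ i, L (EuclideanSpace.basisFun (Fin 3) ℝ i)⟫|
            ≤ ‖EuclideanSpace.basisFun (Fin 3) ℝ i‖ * ‖L (EuclideanSpace.basisFun (Fin 3) ℝ i)‖ :=
              abs_real_inner_le_norm _ _
          _ ≤ 1 * (‖L‖ * ‖EuclideanSpace.basisFun (Fin 3) ℝ i‖) := by
              gcongr
              · simp
              · exact L.le_opNorm _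
          _ = ‖L‖ := by simp
    _ = 3 * ‖L‖ := by simp

/-- The derivative of a coordinate of a field is bounded by the derivative of the field:
`‖D(Zᵢ)(x)‖ ≤ ‖DZ(x)‖`. [folklore] -/
theorem norm_fderiv_coord_le_norm_fderiv {Z : (EuclideanSpace ℝ (Fin 3)) → (EuclideanSpace ℝ (Fin 3))} {x : (EuclideanSpace ℝ (Fin 3))} (hZ : DifferentiableAt ℝ Z x) (i : Fin 3) :
    ‖fderiv ℝ (fun y => Z y i) x‖ ≤ ‖fderiv ℝ Z x‖ := by
  refine ContinuousLinearMap.opNorm_le_bound _ (norm_nonneg _) fun w => ?_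
  rw [fderiv_apply_coord hZ w i, Real.norm_eq_abs]
  exact (abs_coord_le_norm_e3 _ i).trans (ContinuousLinearMap.le_opNorm _ _)

/-- Young's inequality in the form `2ab ≤ (ν/2) a² + (2/ν) b²` (`ν > 0`). [folklore] -/
theorem two_mul_mul_le_add_sq {ν : ℝ} (hν : 0 < ν) (a b : ℝ) :
    2 * (a * b) ≤ ν / 2 * a ^ 2 + 2 / ν * b ^ 2 := by
  have h : 0 ≤ (ν / 2) * (a - 2 / ν * b) ^ 2 := by positivity
  have e : (ν / 2) * (a - 2 / ν * b) ^ 2 = ν / 2 * a ^ 2 + 2 / ν * b ^ 2 - 2 * (a * b) := by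
    field_simp
    ring
  linarith

/-! ### Integration by parts for `∫ ⟪Z, (∇U) Z⟫` -/

/-- `⟪Z, L Z⟫ = ∑ᵢ Zᵢ (L Z)ᵢ` with `(DU(x) w)ᵢ = ⟪∇Uᵢ(x), w⟫`:
`⟪Z(x), DU(x) Z(x)⟫ = ∑ᵢ ⟪∇Uᵢ(x), Zᵢ(x) Z(x)⟫`. [folklore] -/
theorem inner_fderiv_apply_eq_sum {Z U : (EuclideanSpace ℝ (Fin 3)) → (EuclideanSpace ℝ (Fin 3))} {x : (EuclideanSpace ℝ (Fin 3))} (hU : DifferentiableAt ℝ U x) :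
    ⟪Z x, fderiv ℝ U x (Z x)⟫ = ∑ i, ⟪gradient (fun y => U y i) x, (Z x i) • Z x⟫ := by
  rw [PiLp.inner_apply]
  refine Finset.sum_congr rfl fun i _ => ?_
  rw [real_inner_smul_right, inner_gradient_left, fderiv_apply_coord hU (Z x) i]
  simp [mul_comm]

/-- **Integration by parts for the stretching of a compactly supported field by a bounded one**:
for `Z ∈ C¹_c(ℝ³; ℝ³)` and `U ∈ C¹(ℝ³; ℝ³)` with `|U| ≤ S`,
`|∫ ⟪Z, (∇U) Z⟫| ≤ 12 S ∫ |Z| ‖∇Z‖` (`∫⟪∇Uᵢ, ZᵢZ⟫ = −∫ Uᵢ div(ZᵢZ)` and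
`|div(ZᵢZ)| ≤ |Zᵢ||div Z| + |Z|‖∇Zᵢ‖ ≤ 4|Z|‖∇Z‖`). This is how the stretching of the high
vorticity by the velocity of the low vorticity is handled (Lemarié-Rieusset 2016, proof of
Thm. 11.7, the `α`-terms). [cite: LemarieRieusset2016, Thm. 11.7 (proof, PDF pp. 370–371)] -/
theorem abs_integral_inner_fderiv_apply_le_of_hasCompactSupport {Z U : (EuclideanSpace ℝ (Fin 3)) → (EuclideanSpace ℝ (Fin 3))} (hZ : ContDiff ℝ 1 Z)
    (hZc : HasCompactSupport Z) (hU : ContDiff ℝ 1 U) {S : ℝ} (hS : ∀ x, ‖U x‖ ≤ S) :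
    |∫ x, ⟪Z x, fderiv ℝ U x (Z x)⟫| ≤ 12 * S * ∫ x, ‖Z x‖ * ‖fderiv ℝ Z x‖ := by
  have hS0 : 0 ≤ S := (norm_nonneg _).trans (hS 0)
  have hZd : ∀ x, DifferentiableAt ℝ Z x := fun x => (hZ.differentiable one_ne_zero) x
  have hUd : ∀ x, DifferentiableAt ℝ U x := fun x => (hU.differentiable one_ne_zero) x
  have hZcont : Continuous Z := hZ.continuous
  have hDZ : Continuous (fderiv ℝ Z) := hZ.continuous_fderiv one_ne_zero
  -- the coordinate fields
  have hZi : ∀ i : Fin 3, ContDiff ℝ 1 fun y => Z y i := fun i => contDiff_apply_coord hZ i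
  have hUi : ∀ i : Fin 3, ContDiff ℝ 1 fun y => U y i := fun i => contDiff_apply_coord hU i
  set ψ : Fin 3 → (EuclideanSpace ℝ (Fin 3)) → (EuclideanSpace ℝ (Fin 3)) := fun i y => Z y i • Z y with hψ
  have hψ1 : ∀ i, ContDiff ℝ 1 (ψ i) := fun i => (hZi i).smul hZ
  have hψc : ∀ i, HasCompactSupport (ψ i) := fun i => by
    show HasCompactSupport ((fun y => Z y i) • Z)
    exact hZc.smul_left
  -- integrability of `|Z| ‖DZ‖`
  have hprod : Integrable fun x => ‖Z x‖ * ‖fderiv ℝ Z x‖ :=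
    (hZcont.norm.mul hDZ.norm).integrable_of_hasCompactSupport (hZc.norm.mul_right)
  -- each coordinate term
  have hterm : ∀ i : Fin 3, |∫ x, ⟪gradient (fun y => U y i) x, ψ i x⟫| ≤
      4 * S * ∫ x, ‖Z x‖ * ‖fderiv ℝ Z x‖ := by
    intro i
    rw [integral_inner_gradient_eq_neg_integral_mul_divergence (hUi i) (hψ1 i) (hψc i), abs_neg]
    have hpt : ∀ x, ‖U x i * VectorCalculus.divergence (ψ i) x‖ ≤ 4 * S * (‖Z x‖ * ‖fderiv ℝ Z x‖) := by
      intro x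
      rw [norm_mul, Real.norm_eq_abs, Real.norm_eq_abs]
      have hdiv : VectorCalculus.divergence (ψ i) x =
          Z x i * VectorCalculus.divergence Z x + ⟪Z x, gradient (fun y => Z y i) x⟫ := by
        rw [hψ]
        exact divergence_smul_apply ((hZi i).differentiable one_ne_zero x) (hZd x)
      have h1 : |Z x i * VectorCalculus.divergence Z x| ≤ ‖Z x‖ * (3 * ‖fderiv ℝ Z x‖) := by
        rw [abs_mul]
        refine mul_le_mul (abs_coord_le_norm_e3 _ i) ?_ (abs_nonneg _) (norm_nonneg _)
        rw [divergence_eq_traceCLM]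
        exact abs_traceCLM_le_three_mul_opNorm _
      have h2 : |⟪Z x, gradient (fun y => Z y i) x⟫| ≤ ‖Z x‖ * ‖fderiv ℝ Z x‖ := by
        refine (abs_real_inner_le_norm _ _).trans (mul_le_mul_of_nonneg_left ?_ (norm_nonneg _))
        rw [gradient, LinearIsometryEquiv.norm_map]
        exact norm_fderiv_coord_le_norm_fderiv (hZd x) i
      have h3 : |VectorCalculus.divergence (ψ i) x| ≤ 4 * (‖Z x‖ * ‖fderiv ℝ Z x‖) := by
        rw [hdiv]
        refine (abs_add_le _ _).trans ?_
        linarith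
      calc |U x i| * |VectorCalculus.divergence (ψ i) x| ≤ S * (4 * (‖Z x‖ * ‖fderiv ℝ Z x‖)) :=
            mul_le_mul ((abs_coord_le_norm_e3 _ i).trans (hS x)) h3 (abs_nonneg _) hS0
        _ = 4 * S * (‖Z x‖ * ‖fderiv ℝ Z x‖) := by ring
    have h := norm_integral_le_of_norm_le (hprod.const_mul (4 * S)) (Eventually.of_forall hpt)
    rw [Real.norm_eq_abs, integral_const_mul] at h
    exact h
  -- integrability of the coordinate integrands
  have hint : ∀ i : Fin 3, Integrable fun x => ⟪gradient (fun y => U y i) x, ψ i x⟫ := fun i =>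
    ((continuous_gradient_of_contDiff (hUi i)).inner (hψ1 i).continuous).integrable_of_hasCompactSupport
      ((hψc i).mono fun x hx => by
        rw [mem_support] at hx ⊢
        intro h
        exact hx (by rw [h, inner_zero_right]))
  -- assemble
  have heq : ∫ x, ⟪Z x, fderiv ℝ U x (Z x)⟫ = ∑ i, ∫ x, ⟪gradient (fun y => U y i) x, ψ i x⟫ := by
    rw [← integral_finsetSum _ fun i _ => hint i]
    exact integral_congr_ae (Eventually.of_forall fun x => inner_fderiv_apply_eq_sum (hUd x))
  rw [heq]
  calc |∑ i, ∫ x, ⟪gradient (fun y => U y i) x, ψ i x⟫|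
      ≤ ∑ i, |∫ x, ⟪gradient (fun y => U y i) x, ψ i x⟫| := Finset.abs_sum_le_sum_abs _ _
    _ ≤ ∑ _i : Fin 3, 4 * S * ∫ x, ‖Z x‖ * ‖fderiv ℝ Z x‖ := Finset.sum_le_sum fun i _ => hterm i
    _ = 12 * S * ∫ x, ‖Z x‖ * ‖fderiv ℝ Z x‖ := by simp; ring

/-! ### `L²` bookkeeping -/

/-- `∫⁻ ‖f‖ₑ² < ∞` from integrability of `‖f‖²`. [folklore] -/
theorem lintegral_enorm_sq_lt_top_of_integrable_sq {α : Type*} [MeasurableSpace α] {μ : Measure α}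
    {F : Type*} [NormedAddCommGroup F] {f : α → F} (h : Integrable (fun x => ‖f x‖ ^ 2) μ) :
    ∫⁻ x, ‖f x‖ₑ ^ 2 ∂μ < ⊤ := by
  have h2 := h.2
  rw [hasFiniteIntegral_iff_enorm] at h2
  refine lt_of_le_of_lt (le_of_eq (lintegral_congr fun x => ?_)) h2
  rw [Real.enorm_eq_ofReal (sq_nonneg _), ← ofReal_norm, ENNReal.ofReal_pow (norm_nonneg _)]

/-- `‖f‖_{L²} = √(∫ ‖f‖²)` for continuous `f` with `‖f‖²` integrable. [folklore] -/
theorem toReal_eLpNorm_two_eq_sqrt {F : Type*} [NormedAddCommGroup F] [NormedSpace ℝ F] {f : (EuclideanSpace ℝ (Fin 3)) → F}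
    (hf : Continuous f) (h : Integrable fun x => ‖f x‖ ^ 2) :
    (eLpNorm f 2 volume).toReal = Real.sqrt (∫ x, ‖f x‖ ^ 2) := by
  have hm : MemLp f 2 volume := (memLp_two_iff_integrable_sq_norm hf.aestronglyMeasurable).2 h
  rw [MemLp.eLpNorm_eq_integral_rpow_norm two_ne_zero ENNReal.ofNat_ne_top hm,
    ENNReal.toReal_ofReal (by positivity), Real.sqrt_eq_rpow, ENNReal.toReal_ofNat, one_div]
  congr 1
  exact integral_congr_ae (Eventually.of_forall fun x => by simp)

/-- Cauchy–Schwarz: `∫ ‖f‖ ‖g‖ ≤ √(∫‖f‖²) √(∫‖g‖²)` for continuous `f, g` with integrable squares. [folklore] -/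
theorem integral_norm_mul_norm_le_sqrt {F G : Type*} [NormedAddCommGroup F] [NormedSpace ℝ F]
    [NormedAddCommGroup G] [NormedSpace ℝ G] {f : (EuclideanSpace ℝ (Fin 3)) → F} {g : (EuclideanSpace ℝ (Fin 3)) → G}
    (hf : Continuous f) (hg : Continuous g) (hf2 : Integrable fun x => ‖f x‖ ^ 2)
    (hg2 : Integrable fun x => ‖g x‖ ^ 2) :
    ∫ x, ‖f x‖ * ‖g x‖ ≤ Real.sqrt (∫ x, ‖f x‖ ^ 2) * Real.sqrt (∫ x, ‖g x‖ ^ 2) := by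
  have hfm : MemLp (fun x => ‖f x‖) (ENNReal.ofReal 2) volume := by
    rw [show ENNReal.ofReal 2 = (2 : ℝ≥0∞) by norm_num,
      memLp_two_iff_integrable_sq_norm hf.norm.aestronglyMeasurable]
    exact hf2.congr (Eventually.of_forall fun x => by simp)
  have hgm : MemLp (fun x => ‖g x‖) (ENNReal.ofReal 2) volume := by
    rw [show ENNReal.ofReal 2 = (2 : ℝ≥0∞) by norm_num,
      memLp_two_iff_integrable_sq_norm hg.norm.aestronglyMeasurable]
    exact hg2.congr (Eventually.of_forall fun x => by simp)
  have h := integral_mul_le_Lp_mul_Lq_of_nonneg Real.HolderConjugate.two_two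
    (Eventually.of_forall fun x => norm_nonneg (f x)) (Eventually.of_forall fun x => norm_nonneg (g x))
    hfm hgm
  refine h.trans (le_of_eq ?_)
  rw [Real.sqrt_eq_rpow, Real.sqrt_eq_rpow]
  congr 2 <;> exact integral_congr_ae (Eventually.of_forall fun x => by simp)

/-! ### The vorticity of an `H²` field with bounded Hessian decays -/

/-- **The curl of a `C²` field with `∇v ∈ L²` and `∇²v` bounded tends to `0` at infinity**
(`curl v ∈ L²` and Lipschitz). [folklore] -/
theorem tendsto_curl_cocompact {v : (EuclideanSpace ℝ (Fin 3)) → (EuclideanSpace ℝ (Fin 3))} (hv : ContDiff ℝ 2 v)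
    (hG : Integrable fun x => ‖fderiv ℝ v x‖ ^ 2) {B : ℝ} (hB : ∀ x, ‖fderiv ℝ (fderiv ℝ v) x‖ ≤ B) :
    Tendsto (curl v) (cocompact (EuclideanSpace ℝ (Fin 3))) (𝓝 0) := by
  have hω1 : ContDiff ℝ 1 (curl v) := contDiff_curl (n := 1) (by exact hv)
  have hB0 : 0 ≤ B := (norm_nonneg _).trans (hB 0)
  -- Lipschitz
  have hlip : LipschitzWith (Real.toNNReal (‖curlCLM‖ * B)) (curl v) := by
    refine lipschitzWith_of_nnnorm_fderiv_le (hω1.differentiable one_ne_zero) fun x => ?_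
    rw [← NNReal.coe_le_coe, coe_nnnorm, Real.coe_toNNReal _ (mul_nonneg (norm_nonneg _) hB0),
      fderiv_curl hv]
    exact (ContinuousLinearMap.opNorm_comp_le _ _).trans (mul_le_mul_of_nonneg_left (hB x) (norm_nonneg _))
  -- square integrable
  have hsq : Integrable fun x => ‖curl v x‖ ^ 2 := by
    refine (hG.const_mul (‖curlCLM‖ ^ 2)).mono' ((hω1.continuous.norm.pow 2).aestronglyMeasurable)
      (Eventually.of_forall fun x => ?_)
    rw [Real.norm_of_nonneg (sq_nonneg _), ← mul_pow]
    exact pow_le_pow_left₀ (norm_nonneg _) (norm_curl_le v x) 2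
  exact tendsto_cocompact_of_lipschitzWith_of_integrable_sq hlip hsq

/-! ### The geometric depletion for the high part -/

/-- **Depleted stretching of the high vorticity by its own velocity** (Constantin–Fefferman 1993,
§2; Lemarié-Rieusset 2016, proof of Thm. 11.7, the `ββ`-term). There is an absolute `A ≥ 0`
such that: for a `C¹` field `w` whose high part `w_hi = (1 − θ_R(w)) w` (`R > 0`) has compact
support, a threshold `Ω ≤ R` with the direction hypothesis
`√(1 − ⟪ξ(x), ξ(y)⟫²) ≤ |x−y|/ρ` on `{|w| > Ω}`, and a bound `M` for the depleted potentials
`∫ min(1,|x−y|/ρ)|x−y|⁻³ |w_hi(y)| dy ≤ M` (integrable integrands), one has at every `x`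
`|⟪w_hi(x), ∇(K ∗ w_hi)(x) w_hi(x)⟫| ≤ A M |w(x)|²`. [cite: ConstantinFeffermanIndiana1993, §2; LemarieRieusset2016, Thm. 11.7 (proof, PDF pp. 370–371)] -/
theorem exists_abs_inner_highPart_fderiv_biotSavart_le :
    ∃ A : ℝ, 0 ≤ A ∧ ∀ ⦃w : (EuclideanSpace ℝ (Fin 3)) → (EuclideanSpace ℝ (Fin 3))⦄ (_ : ContDiff ℝ 1 w) ⦃R Ω ρ : ℝ⦄ (_ : 0 < R) (_ : Ω ≤ R)
      (_ : 0 < ρ) (_ : HasCompactSupport fun y => (1 - radialCutoff R (2 * R) (w y)) • w y)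
      (_ : ∀ x y, Ω < ‖w x‖ → Ω < ‖w y‖ →
        Real.sqrt (1 - ⟪vorticityDirection w x, vorticityDirection w y⟫ ^ 2) ≤ ‖x - y‖ / ρ)
      ⦃M : ℝ⦄ (_ : ∀ x, Integrable fun y => min 1 (‖x - y‖ / ρ) * (‖x - y‖ ^ 3)⁻¹ *
        ‖(1 - radialCutoff R (2 * R) (w y)) • w y‖)
      (_ : ∀ x, ∫ y, min 1 (‖x - y‖ / ρ) * (‖x - y‖ ^ 3)⁻¹ *
        ‖(1 - radialCutoff R (2 * R) (w y)) • w y‖ ≤ M) (x : (EuclideanSpace ℝ (Fin 3))),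
      |⟪(1 - radialCutoff R (2 * R) (w x)) • w x,
        fderiv ℝ (biotSavart fun y => (1 - radialCutoff R (2 * R) (w y)) • w y) x
          ((1 - radialCutoff R (2 * R) (w x)) • w x)⟫| ≤ A * M * ‖w x‖ ^ 2 := by
  obtain ⟨A, hA0, hdep⟩ := exists_abs_inner_fderiv_biotSavart_le
  refine ⟨A, hA0, ?_⟩
  intro w hw R Ω ρ hR hΩR hρ hhic hdir M hint hM x
  set hi : (EuclideanSpace ℝ (Fin 3)) → (EuclideanSpace ℝ (Fin 3)) := fun y => (1 - radialCutoff R (2 * R) (w y)) • w y with hhi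
  have hM0 : 0 ≤ M := (integral_nonneg fun y =>
    mul_nonneg (depletedKernel_nonneg ρ hρ.le _) (norm_nonneg _)).trans (hM x)
  by_cases hx : hi x = 0
  · have : (1 - radialCutoff R (2 * R) (w x)) • w x = 0 := hx
    rw [this, inner_zero_left, abs_zero]
    positivity
  -- the direction at `x`
  have hwR : R < ‖w x‖ := lt_norm_of_highPart_ne_zero hR hx
  have hw0 : w x ≠ 0 := by
    intro h; rw [h, norm_zero] at hwR; exact lt_irrefl _ (hR.trans hwR)
  set e : (EuclideanSpace ℝ (Fin 3)) := vorticityDirection w x with he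
  have he1 : ‖e‖ = 1 := norm_vorticityDirection w hw0
  set c : ℝ := (1 - radialCutoff R (2 * R) (w x)) * ‖w x‖ with hc
  have hhix : hi x = c • e := highPart_eq_smul_vorticityDirection w R x
  have hc0 : 0 ≤ c := mul_nonneg (sub_nonneg.2 (radialCutoff_le_one _ _ _)) (norm_nonneg _)
  have hcle : c ≤ ‖w x‖ := mul_le_of_le_one_left (norm_nonneg _) (sub_le_self _ (radialCutoff_nonneg _ _ _))
  -- Hölder continuity of the high part
  have hhi1 : ContDiff ℝ 1 hi := contDiff_highPart hw R
  obtain ⟨Cl, hCl⟩ := hhi1.lipschitzWith_of_hasCompactSupport hhic one_ne_zero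
  have hhol : HolderWith Cl 1 hi := hCl.holderWith
  -- the depleted majorant
  set g : (EuclideanSpace ℝ (Fin 3)) → ℝ := fun y => A * (min 1 (‖x - y‖ / ρ) * (‖x - y‖ ^ 3)⁻¹ * ‖hi y‖) with hg
  have hgi : Integrable g := (hint x).const_mul A
  have hdom : ∀ y, y ≠ x → A * ‖hi y - ⟪hi y, e⟫ • e‖ * (‖x - y‖ ^ 3)⁻¹ ≤ g y := by
    intro y _
    have hxΩ : Ω < ‖w x‖ := hΩR.trans_lt hwR
    have hle : ‖hi y - ⟪hi y, e⟫ • e‖ ≤ ‖hi y‖ * min 1 (‖x - y‖ / ρ) := by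
      refine norm_highPart_sub_inner_smul_le hR he1 fun hyR => ?_
      exact hdir x y hxΩ (hΩR.trans_lt hyR)
    rw [hg]
    calc A * ‖hi y - ⟪hi y, e⟫ • e‖ * (‖x - y‖ ^ 3)⁻¹
        ≤ A * (‖hi y‖ * min 1 (‖x - y‖ / ρ)) * (‖x - y‖ ^ 3)⁻¹ := by gcongr
      _ = A * (min 1 (‖x - y‖ / ρ) * (‖x - y‖ ^ 3)⁻¹ * ‖hi y‖) := by ring
  have hkey := hdep one_pos hhol hhic he1 ⟨c, hhix⟩ hgi hdom
  -- assemble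
  have hinner : ⟪hi x, fderiv ℝ (biotSavart hi) x (hi x)⟫ =
      c ^ 2 * ⟪e, fderiv ℝ (biotSavart hi) x e⟫ := by
    rw [hhix, map_smul, real_inner_smul_left, real_inner_smul_right]
    ring
  show |⟪hi x, fderiv ℝ (biotSavart hi) x (hi x)⟫| ≤ A * M * ‖w x‖ ^ 2
  rw [hinner, abs_mul, abs_of_nonneg (sq_nonneg c)]
  have hint_le : ∫ y, g y ≤ A * M := by
    rw [hg, integral_const_mul]
    exact mul_le_mul_of_nonneg_left (hM x) hA0
  calc c ^ 2 * |⟪e, fderiv ℝ (biotSavart hi) x e⟫| ≤ ‖w x‖ ^ 2 * (A * M) :=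
        mul_le_mul (pow_le_pow_left₀ hc0 hcle 2) (hkey.trans hint_le) (abs_nonneg _) (sq_nonneg _)
    _ = A * M * ‖w x‖ ^ 2 := by ring

/-! ### Integrability of the depleted potential of a compactly supported density -/

/-- The depleted potential `∫ min(1,|x−y|/ρ)|x−y|⁻³ |h(y)| dy` of a continuous compactly supported
`h` converges absolutely (domination by `ρ⁻¹ sup|h| · 1_{ball}|x−y|⁻²`). [folklore] -/
theorem integrable_depletedKernel_mul_norm {ρ : ℝ} (hρ : 0 < ρ) {h : (EuclideanSpace ℝ (Fin 3)) → (EuclideanSpace ℝ (Fin 3))} (hh : Continuous h)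
    (hhc : HasCompactSupport h) (x : (EuclideanSpace ℝ (Fin 3))) :
    Integrable fun y => min 1 (‖x - y‖ / ρ) * (‖x - y‖ ^ 3)⁻¹ * ‖h y‖ := by
  obtain ⟨M₀, hM₀⟩ := hh.bounded_above_of_compact_support hhc
  have hM₀0 : 0 ≤ M₀ := (norm_nonneg _).trans (hM₀ x)
  obtain ⟨R₀, hR₀⟩ := hhc.isCompact.isBounded.subset_closedBall (0 : (EuclideanSpace ℝ (Fin 3)))
  set ρ' : ℝ := |R₀| + ‖x‖ + 1 with hρ'
  have hmaj : Integrable fun y => ρ⁻¹ * M₀ * kernelMajorant ρ' (x - y) :=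
    ((integrable_kernelMajorant ρ').comp_sub_left x).const_mul _
  have hmeas : AEStronglyMeasurable
      (fun y => min 1 (‖x - y‖ / ρ) * (‖x - y‖ ^ 3)⁻¹ * ‖h y‖) volume := by
    refine ((Measurable.mul ?_ ?_).mul hh.measurable.norm).aestronglyMeasurable
    · exact measurable_const.min ((measurable_const.sub measurable_id).norm.div_const ρ)
    · exact ((measurable_const.sub measurable_id).norm.pow_const 3).inv
  refine hmaj.mono' hmeas (Eventually.of_forall fun y => ?_)
  rw [Real.norm_of_nonneg (mul_nonneg (depletedKernel_nonneg ρ hρ.le _) (norm_nonneg _))]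
  by_cases hy : h y = 0
  · rw [hy, norm_zero, mul_zero]
    exact mul_nonneg (by positivity) (kernelMajorant_nonneg _ _)
  · have hyR : ‖y‖ ≤ R₀ := mem_closedBall_zero_iff.1 (hR₀ (subset_tsupport _ (mem_support.2 hy)))
    have hxy : ‖x - y‖ < ρ' := by
      calc ‖x - y‖ ≤ ‖x‖ + ‖y‖ := norm_sub_le _ _
        _ < |R₀| + ‖x‖ + 1 := by linarith [le_abs_self R₀]
    have hmem : x - y ∈ ball (0 : (EuclideanSpace ℝ (Fin 3))) ρ' := mem_ball_zero_iff.2 hxy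
    rw [kernelMajorant, indicator_of_mem hmem]
    rcases eq_or_lt_of_le (norm_nonneg (x - y)) with h0 | h0
    · rw [← h0]; simp
    · have hk : min 1 (‖x - y‖ / ρ) * (‖x - y‖ ^ 3)⁻¹ ≤ ρ⁻¹ * (‖x - y‖ ^ 2)⁻¹ := by
        calc min 1 (‖x - y‖ / ρ) * (‖x - y‖ ^ 3)⁻¹ ≤ (‖x - y‖ / ρ) * (‖x - y‖ ^ 3)⁻¹ :=
              mul_le_mul_of_nonneg_right (min_le_right _ _) (by positivity)
          _ = ρ⁻¹ * (‖x - y‖ ^ 2)⁻¹ := by field_simp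
      calc min 1 (‖x - y‖ / ρ) * (‖x - y‖ ^ 3)⁻¹ * ‖h y‖ ≤ ρ⁻¹ * (‖x - y‖ ^ 2)⁻¹ * M₀ :=
            mul_le_mul hk (hM₀ y) (norm_nonneg _) (by positivity)
        _ = ρ⁻¹ * M₀ * (‖x - y‖ ^ 2)⁻¹ := by ring

/-! ### Elementary inequalities -/

/-- The low terms of the splitting: `|⟪lo, L w⟫ + ⟪hi, L lo⟫| ≤ r (‖L‖² + ‖w‖²)` when
`‖lo‖ ≤ r`, `‖hi‖ ≤ ‖w‖`. [folklore] -/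
theorem abs_inner_low_terms_le {lo hi w : (EuclideanSpace ℝ (Fin 3))} (L : (EuclideanSpace ℝ (Fin 3)) →L[ℝ] (EuclideanSpace ℝ (Fin 3))) {r : ℝ} (hr : 0 ≤ r)
    (hlo : ‖lo‖ ≤ r) (hhi : ‖hi‖ ≤ ‖w‖) :
    |⟪lo, L w⟫ + ⟪hi, L lo⟫| ≤ r * (‖L‖ ^ 2 + ‖w‖ ^ 2) := by
  have h1 : |⟪lo, L w⟫| ≤ r * (‖L‖ * ‖w‖) := by
    calc |⟪lo, L w⟫| ≤ ‖lo‖ * ‖L w‖ := abs_real_inner_le_norm _ _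
      _ ≤ r * (‖L‖ * ‖w‖) := mul_le_mul hlo (L.le_opNorm _) (norm_nonneg _) hr
  have h2 : |⟪hi, L lo⟫| ≤ r * (‖L‖ * ‖w‖) := by
    calc |⟪hi, L lo⟫| ≤ ‖hi‖ * ‖L lo‖ := abs_real_inner_le_norm _ _
      _ ≤ ‖w‖ * (‖L‖ * r) :=
          mul_le_mul hhi ((L.le_opNorm _).trans (mul_le_mul_of_nonneg_left hlo (norm_nonneg _)))
            (norm_nonneg _) (norm_nonneg _)
      _ = r * (‖L‖ * ‖w‖) := by ring
  have h3 : ‖L‖ * ‖w‖ ≤ (‖L‖ ^ 2 + ‖w‖ ^ 2) / 2 := by nlinarith [sq_nonneg (‖L‖ - ‖w‖)]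
  calc |⟪lo, L w⟫ + ⟪hi, L lo⟫| ≤ |⟪lo, L w⟫| + |⟪hi, L lo⟫| := abs_add_le _ _
    _ ≤ 2 * (r * (‖L‖ * ‖w‖)) := by linarith
    _ ≤ 2 * (r * ((‖L‖ ^ 2 + ‖w‖ ^ 2) / 2)) := by gcongr
    _ = r * (‖L‖ ^ 2 + ‖w‖ ^ 2) := by ring

/-- **The final count of the Constantin–Fefferman estimate** (Young's inequality twice and
`√Y ≤ 1 + Y`): the arithmetic turning the three bounds
`2T_E ≤ 8ΩF + 8ΩY`, `T_B ≤ 12 c S' √Y √D`, `T_G ≤ A(c₁K√D + c₂√Y)Y`, `S'² ≤ 3(64Ω² + C_b²Y + C_v²E)`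
into `2(T_E + T_B + T_G) ≤ νD + (C₁ + C₂Y + C₃E)Y + 8ΩF`. [cite: LemarieRieusset2016, Thm. 11.7 (proof, final display p. 371)] -/
theorem stretching_count {ν Ω A c₁ c₂ K Cb Cv cθ Y D E F TE TB TG S' : ℝ} (hν : 0 < ν)
    (hA : 0 ≤ A) (hc₂ : 0 ≤ c₂) (hY : 0 ≤ Y) (hD : 0 ≤ D)
    (hTE : 2 * TE ≤ 8 * Ω * F + 8 * Ω * Y)
    (hTB : TB ≤ 12 * cθ * S' * Real.sqrt Y * Real.sqrt D)
    (hTG : TG ≤ A * (c₁ * (K * Real.sqrt D) + c₂ * Real.sqrt Y) * Y)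
    (hS' : S' ^ 2 ≤ 3 * (64 * Ω ^ 2 + Cb ^ 2 * Y + Cv ^ 2 * E)) :
    2 * (TE + (TB + TG)) ≤
      ν * D + ((8 * Ω + 2 / ν * 144 * cθ ^ 2 * (3 * (64 * Ω ^ 2)) + 2 * A * c₂) +
        (2 / ν * 144 * cθ ^ 2 * (3 * Cb ^ 2) + 2 / ν * (A * c₁ * K) ^ 2 + 2 * A * c₂) * Y +
        (2 / ν * 144 * cθ ^ 2 * (3 * Cv ^ 2)) * E) * Y + 8 * Ω * F := by
  set sY : ℝ := Real.sqrt Y with hsY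
  set sD : ℝ := Real.sqrt D with hsD
  have hsY0 : 0 ≤ sY := Real.sqrt_nonneg _
  have hsD0 : 0 ≤ sD := Real.sqrt_nonneg _
  have hsY2 : sY ^ 2 = Y := Real.sq_sqrt hY
  have hsD2 : sD ^ 2 = D := Real.sq_sqrt hD
  have hy1 : 2 * (sD * (12 * cθ * S' * sY)) ≤ ν / 2 * sD ^ 2 + 2 / ν * (12 * cθ * S' * sY) ^ 2 :=
    two_mul_mul_le_add_sq hν _ _
  have hy2 : 2 * (sD * (A * c₁ * K * Y)) ≤ ν / 2 * sD ^ 2 + 2 / ν * (A * c₁ * K * Y) ^ 2 :=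
    two_mul_mul_le_add_sq hν _ _
  have hsYle : sY ≤ 1 + Y := by nlinarith [sq_nonneg (sY - 1)]
  -- group `B`
  have gB : 2 * TB ≤ ν / 2 * D + 2 / ν * 144 * cθ ^ 2 * (3 * (64 * Ω ^ 2 + Cb ^ 2 * Y + Cv ^ 2 * E)) * Y := by
    have h1 : 2 * TB ≤ ν / 2 * D + 2 / ν * (144 * cθ ^ 2 * S' ^ 2 * Y) := by
      have h := hy1
      rw [hsD2, show (12 * cθ * S' * sY) ^ 2 = 144 * cθ ^ 2 * S' ^ 2 * sY ^ 2 by ring, hsY2] at h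
      linarith
    have h3 : S' ^ 2 * Y ≤ 3 * (64 * Ω ^ 2 + Cb ^ 2 * Y + Cv ^ 2 * E) * Y :=
      mul_le_mul_of_nonneg_right hS' hY
    have h4 : 0 ≤ 2 / ν * 144 * cθ ^ 2 := by positivity
    have h5 := mul_le_mul_of_nonneg_left h3 h4
    have e1 : 2 / ν * (144 * cθ ^ 2 * S' ^ 2 * Y) = 2 / ν * 144 * cθ ^ 2 * (S' ^ 2 * Y) := by ring
    have e2 : 2 / ν * 144 * cθ ^ 2 * (3 * (64 * Ω ^ 2 + Cb ^ 2 * Y + Cv ^ 2 * E) * Y) =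
        2 / ν * 144 * cθ ^ 2 * (3 * (64 * Ω ^ 2 + Cb ^ 2 * Y + Cv ^ 2 * E)) * Y := by ring
    linarith
  -- group `G`
  have gG : 2 * TG ≤ ν / 2 * D + 2 / ν * (A * c₁ * K) ^ 2 * Y * Y + 2 * A * c₂ * (1 + Y) * Y := by
    have e0 : A * (c₁ * (K * sD) + c₂ * sY) * Y = sD * (A * c₁ * K * Y) + A * c₂ * sY * Y := by ring
    have h1 : 2 * TG ≤ 2 * (sD * (A * c₁ * K * Y)) + 2 * (A * c₂ * sY * Y) := by
      rw [e0] at hTG; linarith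
    have h2 : A * c₂ * sY * Y ≤ A * c₂ * (1 + Y) * Y := by
      have := mul_le_mul_of_nonneg_left hsYle (by positivity : 0 ≤ A * c₂ * Y)
      have e1 : A * c₂ * Y * sY = A * c₂ * sY * Y := by ring
      have e2 : A * c₂ * Y * (1 + Y) = A * c₂ * (1 + Y) * Y := by ring
      linarith
    have h3 := hy2
    rw [hsD2, show (A * c₁ * K * Y) ^ 2 = (A * c₁ * K) ^ 2 * Y * Y by ring] at h3
    linarith
  have hfin : 2 * (TE + (TB + TG)) ≤ 8 * Ω * F + 8 * Ω * Y +
      (ν / 2 * D + 2 / ν * 144 * cθ ^ 2 * (3 * (64 * Ω ^ 2 + Cb ^ 2 * Y + Cv ^ 2 * E)) * Y) +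
      (ν / 2 * D + 2 / ν * (A * c₁ * K) ^ 2 * Y * Y + 2 * A * c₂ * (1 + Y) * Y) := by linarith
  refine hfin.trans (le_of_eq ?_)
  ring

/-! ### The Constantin–Fefferman stretching estimate -/

set_option maxHeartbeats 800000 in
/-- **The Constantin–Fefferman estimate of the stretching term** (Constantin–Fefferman 1993,
Theorem of §1, the a priori estimate of §2; Lemarié-Rieusset 2016, proof of Thm. 11.7, final
differential inequality). For `ν, Ω, ρ > 0` there are constants `C₁, …, C₄ ≥ 0` such that for every
divergence-free `v ∈ C²(ℝ³; ℝ³)` with `v, ∇v, ∇²v ∈ L²`, `∇²v` bounded, and vorticity direction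
`ξ = ω/|ω|` (`ω = curl v`) satisfying `√(1 − ⟪ξ(x), ξ(y)⟫²) ≤ |x − y|/ρ` whenever
`|ω(x)|, |ω(y)| > Ω`:
`2 ∫⟪ω, (∇v)ω⟫ ≤ ν ∫|∇ω|²_F + (C₁ + C₂∫|ω|² + C₃∫|v|²) ∫|ω|² + C₄ ∫|∇v|²_F`.
See the module docstring for the proof (smooth high/low splitting, integration by parts with the
sup bound of `LocalHelmholtzSupBound`, geometric depletion of `VorticityDirectionDepletion`, the
kernel bound of `DepletedKernelBounds`, Sobolev and Young). [cite: ConstantinFeffermanIndiana1993, Theorem (§1) and §2; LemarieRieusset2016, Thm. 11.7 (proof, PDF pp. 369–371)] -/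
theorem exists_two_mul_integral_stretching_le {ν Ω ρ : ℝ} (hν : 0 < ν) (hΩ : 0 < Ω) (hρ : 0 < ρ) :
    ∃ C₁ C₂ C₃ C₄ : ℝ, 0 ≤ C₁ ∧ 0 ≤ C₂ ∧ 0 ≤ C₃ ∧ 0 ≤ C₄ ∧
      ∀ ⦃v : (EuclideanSpace ℝ (Fin 3)) → (EuclideanSpace ℝ (Fin 3))⦄ (_ : ContDiff ℝ 2 v)
        (_ : VectorCalculus.IsDivFree v)
        (_ : Integrable fun x => ‖v x‖ ^ 2) (_ : Integrable fun x => ‖fderiv ℝ v x‖ ^ 2)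
        (_ : Integrable fun x => ‖fderiv ℝ (fderiv ℝ v) x‖ ^ 2)
        (_ : ∃ B : ℝ, ∀ x, ‖fderiv ℝ (fderiv ℝ v) x‖ ≤ B)
        (_ : ∀ x y, Ω < ‖curl v x‖ → Ω < ‖curl v y‖ →
          Real.sqrt (1 - ⟪vorticityDirection (curl v) x, vorticityDirection (curl v) y⟫ ^ 2) ≤
            ‖x - y‖ / ρ),
        2 * ∫ x, ⟪curl v x, fderiv ℝ v x (curl v x)⟫ ≤
          ν * (∫ x, frobeniusNormSq (fderiv ℝ (curl v) x)) +
            (C₁ + C₂ * (∫ x, ‖curl v x‖ ^ 2) + C₃ * (∫ x, ‖v x‖ ^ 2)) * (∫ x, ‖curl v x‖ ^ 2) +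
            C₄ * (∫ x, frobeniusNormSq (fderiv ℝ v x)) := by
  -- universal constants
  obtain ⟨A, hA0, hdep⟩ := exists_abs_inner_highPart_fderiv_biotSavart_le
  obtain ⟨c₁, c₂, hc₁, hc₂, hker⟩ := exists_integral_depletedKernel_le hρ
  obtain ⟨Cb, Cv, hCb, hCv, hsup⟩ := exists_norm_sub_biotSavart_le
  obtain ⟨Bθ, hBθ0, hBθ⟩ := exists_norm_fderiv_radialCutoff_le
  set K : ℝ := ((SNormLESNormFDerivOfEqConst (EuclideanSpace ℝ (Fin 3)) (volume : Measure (EuclideanSpace ℝ (Fin 3))) 2 : ℝ≥0) : ℝ) with hK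
  have hK0 : 0 ≤ K := NNReal.coe_nonneg _
  set cθ : ℝ := 1 + 2 * Bθ
  have hcθ0 : 0 ≤ cθ := by positivity
  refine ⟨8 * Ω + 2 / ν * 144 * cθ ^ 2 * (3 * (64 * Ω ^ 2)) + 2 * A * c₂,
    2 / ν * 144 * cθ ^ 2 * (3 * Cb ^ 2) + 2 / ν * (A * c₁ * K) ^ 2 + 2 * A * c₂,
    2 / ν * 144 * cθ ^ 2 * (3 * Cv ^ 2), 8 * Ω, by positivity, by positivity, by positivity,
    by positivity, ?_⟩
  intro v hv hdiv hE hG hH hbd hdir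
  obtain ⟨B, hB⟩ := hbd
  -- ### basic objects
  have hv1 : ContDiff ℝ 1 v := hv.of_le (by norm_num)
  have hvc : Continuous v := hv.continuous
  have hDv : Continuous (fderiv ℝ v) := hv.continuous_fderiv (by norm_num)
  have hω1 : ContDiff ℝ 1 (curl v) := contDiff_curl (n := 1) (by exact hv)
  have hωc : Continuous (curl v) := hω1.continuous
  have hDω : Continuous (fderiv ℝ (curl v)) := hω1.continuous_fderiv one_ne_zero
  have hωle : ∀ x, ‖curl v x‖ ≤ ‖curlCLM‖ * ‖fderiv ℝ v x‖ := fun x => norm_curl_le v x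
  have hDωle : ∀ x, ‖fderiv ℝ (curl v) x‖ ≤ ‖curlCLM‖ * ‖fderiv ℝ (fderiv ℝ v) x‖ := fun x => by
    rw [fderiv_curl hv]
    exact ContinuousLinearMap.opNorm_comp_le _ _
  -- ### integrability
  have Iω : Integrable fun x => ‖curl v x‖ ^ 2 := by
    refine (hG.const_mul (‖curlCLM‖ ^ 2)).mono' ((hωc.norm.pow 2).aestronglyMeasurable)
      (Eventually.of_forall fun x => ?_)
    rw [Real.norm_of_nonneg (sq_nonneg _), ← mul_pow]
    exact pow_le_pow_left₀ (norm_nonneg _) (hωle x) 2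
  have IDω : Integrable fun x => ‖fderiv ℝ (curl v) x‖ ^ 2 := by
    refine (hH.const_mul (‖curlCLM‖ ^ 2)).mono' ((hDω.norm.pow 2).aestronglyMeasurable)
      (Eventually.of_forall fun x => ?_)
    rw [Real.norm_of_nonneg (sq_nonneg _), ← mul_pow]
    exact pow_le_pow_left₀ (norm_nonneg _) (hDωle x) 2
  have Ifv : Integrable fun x => frobeniusNormSq (fderiv ℝ v x) := by
    refine (hG.const_mul 3).mono' (continuous_frobeniusNormSq_fderiv hv (by norm_num)).aestronglyMeasurable
      (Eventually.of_forall fun x => ?_)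
    rw [Real.norm_of_nonneg (frobeniusNormSq_nonneg _)]
    exact frobeniusNormSq_le_three_mul _
  have Ifω : Integrable fun x => frobeniusNormSq (fderiv ℝ (curl v) x) := by
    refine (IDω.const_mul 3).mono' (continuous_frobeniusNormSq_fderiv hω1 one_ne_zero).aestronglyMeasurable
      (Eventually.of_forall fun x => ?_)
    rw [Real.norm_of_nonneg (frobeniusNormSq_nonneg _)]
    exact frobeniusNormSq_le_three_mul _
  -- ### the quantities
  set Y : ℝ := ∫ x, ‖curl v x‖ ^ 2 with hY
  set D : ℝ := ∫ x, frobeniusNormSq (fderiv ℝ (curl v) x) with hD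
  set E : ℝ := ∫ x, ‖v x‖ ^ 2 with hEdef
  set F : ℝ := ∫ x, frobeniusNormSq (fderiv ℝ v x) with hF
  set Dop : ℝ := ∫ x, ‖fderiv ℝ (curl v) x‖ ^ 2 with hDop
  have hY0 : 0 ≤ Y := integral_nonneg fun x => sq_nonneg _
  have hD0 : 0 ≤ D := integral_nonneg fun x => frobeniusNormSq_nonneg _
  have hE0 : 0 ≤ E := integral_nonneg fun x => sq_nonneg _
  have hF0 : 0 ≤ F := integral_nonneg fun x => frobeniusNormSq_nonneg _
  have hDop0 : 0 ≤ Dop := integral_nonneg fun x => sq_nonneg _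
  have hGle : ∫ x, ‖fderiv ℝ v x‖ ^ 2 ≤ F := integral_mono hG Ifv fun x => sq_opNorm_le_frobeniusNormSq _
  have hDopD : Dop ≤ D := integral_mono IDω Ifω fun x => sq_opNorm_le_frobeniusNormSq _
  set sY : ℝ := Real.sqrt Y with hsY
  set sD : ℝ := Real.sqrt D with hsD
  set sE : ℝ := Real.sqrt E with hsE
  have hsY0 : 0 ≤ sY := Real.sqrt_nonneg _
  have hsD0 : 0 ≤ sD := Real.sqrt_nonneg _
  have hsE0 : 0 ≤ sE := Real.sqrt_nonneg _
  have hsY2 : sY ^ 2 = Y := Real.sq_sqrt hY0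
  have hsD2 : sD ^ 2 = D := Real.sq_sqrt hD0
  have hsE2 : sE ^ 2 = E := Real.sq_sqrt hE0
  have hsDop : Real.sqrt Dop ≤ sD := Real.sqrt_le_sqrt hDopD
  -- `L²` norms as square roots
  have hω2 : (eLpNorm (curl v) 2 volume).toReal = sY := toReal_eLpNorm_two_eq_sqrt hωc Iω
  have hv2 : (eLpNorm v 2 volume).toReal = sE := toReal_eLpNorm_two_eq_sqrt hvc hE
  have hDω2 : (eLpNorm (fderiv ℝ (curl v)) 2 volume).toReal = Real.sqrt Dop :=
    toReal_eLpNorm_two_eq_sqrt hDω IDω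
  have hωm2 : MemLp (curl v) 2 volume := (memLp_two_iff_integrable_sq_norm hωc.aestronglyMeasurable).2 Iω
  have hDωm2 : MemLp (fderiv ℝ (curl v)) 2 volume :=
    (memLp_two_iff_integrable_sq_norm hDω.aestronglyMeasurable).2 IDω
  -- Sobolev `‖ω‖₆ ≤ K ‖∇ω‖₂`
  have hsob := eLpNorm_six_le_eLpNorm_fderiv_two (volume : Measure (EuclideanSpace ℝ (Fin 3))) (F := (EuclideanSpace ℝ (Fin 3)))
    finrank_euclideanSpace_fin hω1 hωm2.eLpNorm_lt_top
  have hω6top : eLpNorm (curl v) 6 volume < ⊤ :=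
    lt_of_le_of_lt hsob (ENNReal.mul_lt_top ENNReal.coe_lt_top hDωm2.eLpNorm_lt_top)
  have hωm6 : MemLp (curl v) 6 volume := ⟨hωc.aestronglyMeasurable, hω6top⟩
  have hω6 : (eLpNorm (curl v) 6 volume).toReal ≤ K * Real.sqrt Dop := by
    have h := ENNReal.toReal_mono (ENNReal.mul_ne_top ENNReal.coe_ne_top hDωm2.eLpNorm_lt_top.ne) hsob
    rwa [ENNReal.toReal_mul, ENNReal.coe_toReal, hDω2] at h
  -- ### splitting
  set R : ℝ := 2 * Ω with hRdef
  have hR : 0 < R := by positivity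
  have hΩR : Ω ≤ R := by linarith
  have hω0 : Tendsto (curl v) (cocompact (EuclideanSpace ℝ (Fin 3))) (𝓝 0) := tendsto_curl_cocompact hv hG hB
  set lo : (EuclideanSpace ℝ (Fin 3)) → (EuclideanSpace ℝ (Fin 3)) := fun y => radialCutoff R (2 * R) (curl v y) • curl v y with hlo
  set hi : (EuclideanSpace ℝ (Fin 3)) → (EuclideanSpace ℝ (Fin 3)) := fun y => (1 - radialCutoff R (2 * R) (curl v y)) • curl v y with hhi
  have hlohi : ∀ y, curl v y = lo y + hi y := fun y => smul_add_one_sub_smul.symm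
  have hlo_le : ∀ y, ‖lo y‖ ≤ 2 * R := fun y => norm_lowPart_le hR y
  have hhi_le : ∀ y, ‖hi y‖ ≤ ‖curl v y‖ := fun y => norm_highPart_le_norm (curl v) R y
  have hhi1 : ContDiff ℝ 1 hi := contDiff_highPart hω1 R
  have hhic : HasCompactSupport hi := hasCompactSupport_highPart hR hω0
  have hhicont : Continuous hi := hhi1.continuous
  have hlocont : Continuous lo := (contDiff_lowPart hω1 R).continuous
  have hDhi_le : ∀ y, ‖fderiv ℝ hi y‖ ≤ cθ * ‖fderiv ℝ (curl v) y‖ := fun y =>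
    norm_fderiv_highPart_le hω1 hBθ0 hBθ hR y
  obtain ⟨Cl, hCl⟩ := hhi1.lipschitzWith_of_hasCompactSupport hhic one_ne_zero
  have hhol : HolderWith Cl 1 hi := hCl.holderWith
  have huhi1 : ContDiff ℝ 1 (biotSavart hi) := contDiff_biotSavart one_pos hhol hhic
  set U : (EuclideanSpace ℝ (Fin 3)) → (EuclideanSpace ℝ (Fin 3)) := fun x => v x - biotSavart hi x with hU
  have hU1 : ContDiff ℝ 1 U := hv1.sub huhi1
  have hDU : ∀ x, fderiv ℝ U x = fderiv ℝ v x - fderiv ℝ (biotSavart hi) x := fun x =>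
    fderiv_fun_sub ((hv1.differentiable one_ne_zero) x) ((huhi1.differentiable one_ne_zero) x)
  -- ### the sup bound for `U`
  have hvl2 : ∫⁻ y, ‖v y‖ₑ ^ 2 < ⊤ := lintegral_enorm_sq_lt_top_of_integrable_sq hE
  have hhi2 : (eLpNorm hi 2 volume).toReal ≤ sY := by
    rw [← hω2]
    refine ENNReal.toReal_mono hωm2.eLpNorm_lt_top.ne (eLpNorm_mono fun y => hhi_le y)
  set S : ℝ := 2 * (2 * R) + Cb * (eLpNorm hi 2 volume).toReal + Cv * (eLpNorm v 2 volume).toReal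
    with hSdef
  have hS : ∀ x, ‖U x‖ ≤ S := fun x => hsup hv hdiv hvl2 hlohi hlo_le hhicont hhic x
  set S' : ℝ := 8 * Ω + Cb * sY + Cv * sE with hS'
  have hSS' : S ≤ S' := by
    have h1 := mul_le_mul_of_nonneg_left hhi2 hCb
    simp only [hSdef, hS']
    rw [hv2]
    linarith [h1, hRdef]
  have hS0 : 0 ≤ S := (norm_nonneg _).trans (hS 0)
  -- ### the depletion inputs
  have hint_k : ∀ x, Integrable fun y => min 1 (‖x - y‖ / ρ) * (‖x - y‖ ^ 3)⁻¹ * ‖hi y‖ :=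
    fun x => integrable_depletedKernel_mul_norm hρ hhicont hhic x
  have hnn : ∀ y, ‖(fun y => ‖hi y‖) y‖ ≤ ‖(fun y => ‖curl v y‖) y‖ := fun y => by
    show ‖‖hi y‖‖ ≤ ‖‖curl v y‖‖
    rw [norm_norm, norm_norm]
    exact hhi_le y
  have hg6 : MemLp (fun y => ‖hi y‖) 6 volume :=
    hωm6.norm.of_le hhicont.norm.aestronglyMeasurable (Eventually.of_forall hnn)
  have hg2 : MemLp (fun y => ‖hi y‖) 2 volume :=
    hωm2.norm.of_le hhicont.norm.aestronglyMeasurable (Eventually.of_forall hnn)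
  set M : ℝ := c₁ * (eLpNorm (fun y => ‖hi y‖) 6 volume).toReal +
    c₂ * (eLpNorm (fun y => ‖hi y‖) 2 volume).toReal with hMdef
  have hM : ∀ x, ∫ y, min 1 (‖x - y‖ / ρ) * (‖x - y‖ ^ 3)⁻¹ * ‖hi y‖ ≤ M := fun x =>
    hker (fun y => norm_nonneg _) hg6 hg2 x (hint_k x)
  have hM0 : 0 ≤ M := by positivity
  have hMle : M ≤ c₁ * (K * sD) + c₂ * sY := by
    have h6 : (eLpNorm (fun y => ‖hi y‖) 6 volume).toReal ≤ K * sD := by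
      have h1 : eLpNorm (fun y => ‖hi y‖) 6 volume ≤ eLpNorm (curl v) 6 volume :=
        eLpNorm_mono fun y => by simpa using hhi_le y
      calc (eLpNorm (fun y => ‖hi y‖) 6 volume).toReal ≤ (eLpNorm (curl v) 6 volume).toReal :=
            ENNReal.toReal_mono hω6top.ne h1
        _ ≤ K * Real.sqrt Dop := hω6
        _ ≤ K * sD := mul_le_mul_of_nonneg_left hsDop hK0
    have h2 : (eLpNorm (fun y => ‖hi y‖) 2 volume).toReal ≤ sY := by
      rw [eLpNorm_norm]; exact hhi2
    rw [hMdef]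
    gcongr
  -- pointwise depletion bound
  have hGpt : ∀ x, |⟪hi x, fderiv ℝ (biotSavart hi) x (hi x)⟫| ≤ A * M * ‖curl v x‖ ^ 2 :=
    fun x => hdep hω1 hR hΩR hρ hhic hdir hint_k hM x
  -- ### the pointwise decomposition of the stretching density
  set Et : (EuclideanSpace ℝ (Fin 3)) → ℝ := fun x => ⟪lo x, fderiv ℝ v x (curl v x)⟫ + ⟪hi x, fderiv ℝ v x (lo x)⟫ with hEt
  set Bt : (EuclideanSpace ℝ (Fin 3)) → ℝ := fun x => ⟪hi x, fderiv ℝ U x (hi x)⟫ with hBt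
  set Gt : (EuclideanSpace ℝ (Fin 3)) → ℝ := fun x => ⟪hi x, fderiv ℝ (biotSavart hi) x (hi x)⟫ with hGt
  have hsplit : ∀ x, ⟪curl v x, fderiv ℝ v x (curl v x)⟫ = Et x + (Bt x + Gt x) := by
    intro x
    have hω' := hlohi x
    have h1 : Bt x + Gt x = ⟪hi x, fderiv ℝ v x (hi x)⟫ := by
      show ⟪hi x, fderiv ℝ U x (hi x)⟫ + ⟪hi x, fderiv ℝ (biotSavart hi) x (hi x)⟫ = _
      rw [← inner_add_right, hDU x, sub_apply, sub_add_cancel]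
    rw [h1]
    show ⟪curl v x, fderiv ℝ v x (curl v x)⟫ =
      (⟪lo x, fderiv ℝ v x (curl v x)⟫ + ⟪hi x, fderiv ℝ v x (lo x)⟫) + ⟪hi x, fderiv ℝ v x (hi x)⟫
    rw [hω']
    simp only [map_add, inner_add_left, inner_add_right]
    ring
  -- integrability of the three pieces
  have hEt_pt : ∀ x, |Et x| ≤ 2 * R * (‖fderiv ℝ v x‖ ^ 2 + ‖curl v x‖ ^ 2) := fun x =>
    abs_inner_low_terms_le (fderiv ℝ v x) (by positivity) (hlo_le x) (hhi_le x)
  have Idom : Integrable fun x => 2 * R * (‖fderiv ℝ v x‖ ^ 2 + ‖curl v x‖ ^ 2) := by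
    have h := (hG.add IDω).const_mul (2 * R)
    have h' := (hG.add Iω).const_mul (2 * R)
    exact h'
  have IEt : Integrable Et := by
    have hcont : Continuous Et :=
      ((hlocont.inner (hDv.clm_apply hωc))).add (hhicont.inner (hDv.clm_apply hlocont))
    refine Idom.mono' hcont.aestronglyMeasurable (Eventually.of_forall fun x => ?_)
    rw [Real.norm_eq_abs]
    exact hEt_pt x
  have hsupp_inner : ∀ (L : (EuclideanSpace ℝ (Fin 3)) → (EuclideanSpace ℝ (Fin 3)) →L[ℝ] (EuclideanSpace ℝ (Fin 3))), Continuous L →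
      Integrable fun x => ⟪hi x, L x (hi x)⟫ := by
    intro L hL
    refine (hhicont.inner (hL.clm_apply hhicont)).integrable_of_hasCompactSupport ?_
    refine hhic.mono fun x hx => ?_
    rw [mem_support] at hx ⊢
    intro h
    exact hx (by rw [h, inner_zero_left])
  have IBt : Integrable Bt := hsupp_inner _ (hU1.continuous_fderiv one_ne_zero)
  have IGt : Integrable Gt := hsupp_inner _ (huhi1.continuous_fderiv one_ne_zero)
  have IBG : Integrable fun x => Bt x + Gt x := IBt.add IGt
  have hP : ∫ x, ⟪curl v x, fderiv ℝ v x (curl v x)⟫ = (∫ x, Et x) + ((∫ x, Bt x) + ∫ x, Gt x) := by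
    rw [← integral_add IBt IGt, ← integral_add IEt IBG]
    exact integral_congr_ae (Eventually.of_forall hsplit)
  -- ### bound of the low terms
  have hTE : ∫ x, Et x ≤ 2 * R * (F + Y) := by
    have h1 : ∫ x, Et x ≤ ∫ x, 2 * R * (‖fderiv ℝ v x‖ ^ 2 + ‖curl v x‖ ^ 2) :=
      integral_mono IEt Idom fun x => (le_abs_self _).trans (hEt_pt x)
    refine h1.trans ?_
    rw [integral_const_mul, integral_add hG Iω]
    exact mul_le_mul_of_nonneg_left (add_le_add hGle le_rfl) (by positivity)
  -- ### bound of the `u_lo` term by integration by parts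
  have Idom2 : Integrable fun x => (‖curl v x‖ ^ 2 + ‖fderiv ℝ (curl v) x‖ ^ 2) / 2 := by
    have h := (Iω.add IDω).div_const 2
    exact h
  have IωDω : Integrable fun x => ‖curl v x‖ * ‖fderiv ℝ (curl v) x‖ := by
    refine Idom2.mono' (hωc.norm.mul hDω.norm).aestronglyMeasurable
      (Eventually.of_forall fun x => ?_)
    rw [Real.norm_of_nonneg (mul_nonneg (norm_nonneg _) (norm_nonneg _))]
    nlinarith [sq_nonneg (‖curl v x‖ - ‖fderiv ℝ (curl v) x‖)]
  have hTB : ∫ x, Bt x ≤ 12 * cθ * S' * sY * sD := by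
    have h1 : |∫ x, Bt x| ≤ 12 * S * ∫ x, ‖hi x‖ * ‖fderiv ℝ hi x‖ :=
      abs_integral_inner_fderiv_apply_le_of_hasCompactSupport hhi1 hhic hU1 hS
    have h2 : ∫ x, ‖hi x‖ * ‖fderiv ℝ hi x‖ ≤ cθ * ∫ x, ‖curl v x‖ * ‖fderiv ℝ (curl v) x‖ := by
      rw [← integral_const_mul]
      refine integral_mono ((hhicont.norm.mul (hhi1.continuous_fderiv one_ne_zero).norm).integrable_of_hasCompactSupport
        (hhic.norm.mul_right)) (IωDω.const_mul cθ) fun x => ?_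
      show ‖hi x‖ * ‖fderiv ℝ hi x‖ ≤ cθ * (‖curl v x‖ * ‖fderiv ℝ (curl v) x‖)
      calc ‖hi x‖ * ‖fderiv ℝ hi x‖ ≤ ‖curl v x‖ * (cθ * ‖fderiv ℝ (curl v) x‖) :=
            mul_le_mul (hhi_le x) (hDhi_le x) (norm_nonneg _) (norm_nonneg _)
        _ = cθ * (‖curl v x‖ * ‖fderiv ℝ (curl v) x‖) := by ring
    have h3 : ∫ x, ‖curl v x‖ * ‖fderiv ℝ (curl v) x‖ ≤ sY * sD :=
      (integral_norm_mul_norm_le_sqrt hωc hDω Iω IDω).trans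
        (mul_le_mul_of_nonneg_left hsDop hsY0)
    have h4 : 0 ≤ ∫ x, ‖hi x‖ * ‖fderiv ℝ hi x‖ := integral_nonneg fun x => by positivity
    calc ∫ x, Bt x ≤ |∫ x, Bt x| := le_abs_self _
      _ ≤ 12 * S * ∫ x, ‖hi x‖ * ‖fderiv ℝ hi x‖ := h1
      _ ≤ 12 * S' * (cθ * (sY * sD)) := by
          refine mul_le_mul (mul_le_mul_of_nonneg_left hSS' (by norm_num)) (h2.trans ?_) h4 (by positivity)
          exact mul_le_mul_of_nonneg_left h3 hcθ0
      _ = 12 * cθ * S' * sY * sD := by ring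
  -- ### bound of the `u_hi` term by geometric depletion
  have hTG : ∫ x, Gt x ≤ A * (c₁ * (K * sD) + c₂ * sY) * Y := by
    have h1 : ∫ x, Gt x ≤ ∫ x, A * M * ‖curl v x‖ ^ 2 :=
      integral_mono IGt (Iω.const_mul (A * M)) fun x => (le_abs_self _).trans (hGpt x)
    rw [integral_const_mul] at h1
    refine h1.trans ?_
    have : A * M * Y ≤ A * (c₁ * (K * sD) + c₂ * sY) * Y :=
      mul_le_mul_of_nonneg_right (mul_le_mul_of_nonneg_left hMle hA0) hY0
    exact this
  -- ### the final count
  have hS'0 : 0 ≤ S' := hS0.trans hSS'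
  have hS'sq : S' ^ 2 ≤ 3 * (64 * Ω ^ 2 + Cb ^ 2 * Y + Cv ^ 2 * E) := by
    have h : S' ^ 2 ≤ 3 * ((8 * Ω) ^ 2 + (Cb * sY) ^ 2 + (Cv * sE) ^ 2) := by
      rw [hS']
      nlinarith [sq_nonneg (8 * Ω - Cb * sY), sq_nonneg (Cb * sY - Cv * sE), sq_nonneg (8 * Ω - Cv * sE)]
    calc S' ^ 2 ≤ 3 * ((8 * Ω) ^ 2 + (Cb * sY) ^ 2 + (Cv * sE) ^ 2) := h
      _ = 3 * (64 * Ω ^ 2 + Cb ^ 2 * Y + Cv ^ 2 * E) := by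
          simp only [mul_pow, hsY2, hsE2]; ring
  have gE : 2 * ∫ x, Et x ≤ 8 * Ω * F + 8 * Ω * Y := by
    have e : 2 * (2 * R * (F + Y)) = 8 * Ω * F + 8 * Ω * Y := by rw [hRdef]; ring
    linarith [hTE]
  rw [hP]
  exact stretching_count hν hA0 hc₂ hY0 hD0 gE hTB hTG hS'sq

end Literature.Analysis.FluidPDE

end
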